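import Summits.Ventures.PercRepro.RankLevelSetUpTo3
import Summits.Ventures.PercRepro.GenQSixFourFinal

/-!
# PercRepro — C-025 FOR EVERY MATROID OF RANK `≤ 6`, AT EVERY `(p, q)` (night-1, gen 6)

An assembly of tree theorems, nothing new proved: for a finite matroid with `ρ(E) ≤ 6` and any pair `q + 2 ≤ p`,
either `ρ(E) < p` and `U(p, q) = ∅` (p2's `RLS_of_eRank_lt`), or `p ≤ 6`, so `q ≤ 4`: the rows `q ≤ 3` are
`C025UpTo_three` (p3, on typer-2's `C025UpTo_two` and `SevenThree.c025_three_all`) and the only pair with `q = 4`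
is `(6, 4)` = night-4's `GenQ.rls_six_four_holds_b`. So all fifteen pairs `(2,0) (3,0) (3,1) (4,0) (4,1) (4,2)
(5,0) (5,1) (5,2) (5,3) (6,0) (6,1) (6,2) (6,3) (6,4)` are closed on every finite matroid and C-025 is a theorem on
every matroid of rank at most `6` (in particular on every matroid with at most `6` elements).

* **`c025_of_p_le_six`** — `p ≤ 6 → q + 2 ≤ p → RLS M p q` on every finite matroid (the fifteen pairs);
* **`c025_of_eRank_le_six`** — `ρ(E) ≤ 6 → ∀ p q, q + 2 ≤ p → RLS M p q`;
* `c025_of_eRank_le_six'` — the literal `C025` body;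
* `c025_of_ncard_le_six` — every matroid with at most `6` elements.
Axioms: standard.
-/

open scoped Matroid

namespace PercRepro

namespace ThmN

variable {α : Type}

/-- **C-025 at every pair `(p, q)` with `p ≤ 6`, on every finite matroid** — the fifteen pairs `(2,0) … (6,4)`:
`C025UpTo_three` for `q ≤ 3` and night-4's `(6, 4)`. -/
theorem c025_of_p_le_six (M : Matroid α) [M.Finite] (p q : ℕ) (hp6 : p ≤ 6) (hqp : q + 2 ≤ p) : RLS M p q := by
  classical
  rcases Nat.lt_or_ge q 4 with hq | hq
  · exact C025UpTo_three M p q (by omega) hqp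
  · have hq4 : q = 4 := by omega
    have hp : p = 6 := by omega
    subst hq4 hp
    exact GenQ.rls_six_four_holds_b M

/-- **C-025 on every matroid of rank `≤ 6`**, every pair `q + 2 ≤ p`. -/
theorem c025_of_eRank_le_six (M : Matroid α) [M.Finite] (h6 : M.eRank ≤ 6) (p q : ℕ) (hqp : q + 2 ≤ p) :
    RLS M p q := by
  classical
  rcases lt_or_ge M.eRank (p : ℕ∞) with hlt | hge
  · exact RLS_of_eRank_lt M hlt
  · have hp6' : (p : ℕ∞) ≤ 6 := hge.trans h6
    have hp6 : p ≤ 6 := by exact_mod_cast hp6'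
    exact c025_of_p_le_six M p q hp6 hqp

/-- **C-025 on every matroid of rank `≤ 6`, the literal `C025` body.** -/
theorem c025_of_eRank_le_six' (M : Matroid α) [M.Finite] (h6 : M.eRank ≤ 6) (p q : ℕ) (hqp : q + 2 ≤ p) :
    phiK p q * ({A : Set α | A ⊆ M.E ∧ M.eRk A = (p : ℕ∞) ∧ M.eRk (M.E \ A) = (q : ℕ∞)}.ncard : ℚ) ≤
      ({A : Set α | A ⊆ M.E ∧ (q : ℕ∞) < M.eRk A ∧ M.eRk A < (p : ℕ∞)}.ncard : ℚ) :=
  c025_of_eRank_le_six M h6 p q hqp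

/-- **C-025 on every matroid with at most `6` elements** (the rank is at most the number of elements). -/
theorem c025_of_ncard_le_six (M : Matroid α) [M.Finite] (h6 : M.E.ncard ≤ 6) (p q : ℕ) (hqp : q + 2 ≤ p) :
    RLS M p q := by
  refine c025_of_eRank_le_six M ?_ p q hqp
  have h1 : M.eRank ≤ M.E.encard := M.eRank_le_encard_ground
  have h2 : M.E.encard = (M.E.ncard : ℕ∞) := M.ground_finite.cast_ncard_eq.symm
  rw [h2] at h1
  exact h1.trans (by exact_mod_cast h6)

end ThmN

end PercRepro
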